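import Mathlib
import Literature.NumberTheory.LFunctions.WeilMellinBounds
import HarnessLib

/-!
# Laplace integrals of profiles on `[0, ∞)` (helper file for stub LOC)

Route `WeilParity`, crux `OffLineParityDetection` (item stmt-RiemannHypothesis-15431), line
`registered`, stub `stub_finiteDefectLocalisation` (LOC).  Pure real/complex analysis, no zeta
facts and no definitions.  For a real profile `f` on `[0, ∞)` the statements of the line use the
Laplace integral `F_f(w) = ∫₀^∞ f(u) e^{-wu} du`, always written out as
`∫ u in Set.Ioi 0, (f u : ℂ) * Complex.exp (-(w * u))`.  This file provides:

* support bookkeeping: a continuous function vanishes off the interior of any set containing its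
  topological support (`loc_eq_zero_of_notMem_interior`), so a profile with `tsupport f ⊆ [0, ∞)`
  vanishes on `(-∞, 0]` and a window function with `tsupport e ⊆ [-a, a]` vanishes off `(-a, a)`;
* the two substitution identities behind the mirror-odd witness `f(a - t) - f(a + t)`:
  `(f(a - ·))^(s) = e^{(s-1/2)a} F_f(s - 1/2)` and `(f(a + ·))^(s) = e^{-(s-1/2)a} ∫₀^∞ f(u) e^{(s-1/2)u} du`
  (`weilMellin g s = ∫ g(t) e^{(s-1/2)t} dt`; translation invariance of Lebesgue measure);
* the weighted bound `‖F_φ(w)‖ ≤ e^{-(Re w) b} (∫₀^∞ φ² + 1/Re w)/2` for `Re w > 0` and a profile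
  `φ` vanishing on `(-∞, b]`, `b ≥ 0` (pointwise `2|φ| e^{-ηu} ≤ φ² e^{-ηb} + e^{-ηu}` on `u > b`);
* additivity of `F` and two exponential identities (`‖e^{-wu}‖`, the square of `e^{(ρ-1/2)a}` on a
  vertical line `Re ρ = 1/2 + η₀`).

Everything is folklore calculus and fully proved.
-/

set_option linter.dupNamespace false

noncomputable section

namespace Summit.RiemannHypothesis.RiemannHypothesis.Theorems.WeilParityOffLineParityDetection

open MeasureTheory Set Filter
open scoped ComplexConjugate
open Literature.NumberTheory.LFunctions

/-! ## Supports -/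

/-- A continuous function vanishes off the interior of any set containing its topological support
(the support of a continuous function is open). [folklore] -/
theorem loc_eq_zero_of_notMem_interior {α E : Type*} [TopologicalSpace α] [TopologicalSpace E]
    [Zero E] [T1Space E] {f : α → E} (hf : Continuous f) {K : Set α} (hK : tsupport f ⊆ K)
    {x : α} (hx : x ∉ interior K) : f x = 0 := by
  by_contra h
  exact hx (interior_maximal ((subset_tsupport f).trans hK) hf.isOpen_support h)

/-- If `f` vanishes off a closed set `K` then `tsupport f ⊆ K`. [folklore] -/
theorem loc_tsupport_subset {α E : Type*} [TopologicalSpace α] [Zero E] {f : α → E} {K : Set α}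
    (hK : IsClosed K) (h : ∀ x ∉ K, f x = 0) : tsupport f ⊆ K :=
  closure_minimal (Function.support_subset_iff'.2 h) hK

/-- A continuous profile with `tsupport f ⊆ [0, ∞)` vanishes on `(-∞, 0]` (including at `0`).
[folklore] -/
theorem loc_profile_eq_zero {f : ℝ → ℝ} (hf : Continuous f) (hs : tsupport f ⊆ Ici 0) {u : ℝ}
    (hu : u ≤ 0) : f u = 0 :=
  loc_eq_zero_of_notMem_interior hf hs (by rw [interior_Ici]; exact not_lt.2 hu)

/-! ## Exponential bookkeeping -/

/-- `‖e^{-wu}‖ = e^{-(Re w) u}` for real `u`. [folklore] -/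
theorem loc_norm_cexp_neg_mul (w : ℂ) (u : ℝ) :
    ‖Complex.exp (-(w * (u : ℂ)))‖ = Real.exp (-(w.re * u)) := by
  rw [Complex.norm_exp]
  congr 1
  simp [Complex.mul_re]

/-- `‖e^{za}‖ = e^{(Re z) a}` for real `a`. [folklore] -/
theorem loc_norm_cexp_mul (z : ℂ) (a : ℝ) : ‖Complex.exp (z * (a : ℂ))‖ = Real.exp (z.re * a) := by
  rw [Complex.norm_exp]
  congr 1
  simp [Complex.mul_re]

/-- On the vertical line `Re ρ = 1/2 + η₀`: `(e^{(ρ-1/2)a})² = e^{2η₀a} · e^{2i(Im ρ)a}`. [folklore] -/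
theorem loc_cexp_sq_of_re {ρ : ℂ} {η₀ : ℝ} (hρ : ρ.re = 1 / 2 + η₀) (a : ℝ) :
    Complex.exp ((ρ - 1 / 2) * (a : ℂ)) ^ 2 =
      (Real.exp (2 * η₀ * a) : ℂ) * Complex.exp (2 * (ρ.im : ℂ) * (a : ℂ) * Complex.I) := by
  rw [sq, ← Complex.exp_add, Complex.ofReal_exp, ← Complex.exp_add]
  congr 1
  apply Complex.ext
  · simp [Complex.mul_re, hρ]
    ring
  · simp [Complex.mul_im]
    ring

/-! ## The Laplace integrand -/

/-- The Laplace integrand `f(u) e^{-wu}` of a continuous compactly supported real profile is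
integrable. [folklore] -/
theorem loc_integrable_lapIntegrand {φ : ℝ → ℝ} (hφ : Continuous φ) (hφs : HasCompactSupport φ)
    (w : ℂ) : Integrable fun u : ℝ ↦ (φ u : ℂ) * Complex.exp (-(w * (u : ℂ))) :=
  ((Complex.continuous_ofReal.comp hφ).mul (by fun_prop)).integrable_of_hasCompactSupport
    ((hφs.comp_left Complex.ofReal_zero).mul_right)

/-- Additivity of the Laplace integral in the profile. [folklore] -/
theorem loc_lap_add {φ ψ : ℝ → ℝ} (hφ : Continuous φ) (hφs : HasCompactSupport φ)
    (hψ : Continuous ψ) (hψs : HasCompactSupport ψ) (w : ℂ) :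
    ∫ u in Ioi (0 : ℝ), ((φ u + ψ u : ℝ) : ℂ) * Complex.exp (-(w * (u : ℂ))) =
      (∫ u in Ioi (0 : ℝ), (φ u : ℂ) * Complex.exp (-(w * (u : ℂ)))) +
        ∫ u in Ioi (0 : ℝ), (ψ u : ℂ) * Complex.exp (-(w * (u : ℂ))) := by
  rw [← integral_add (loc_integrable_lapIntegrand hφ hφs w).integrableOn
    (loc_integrable_lapIntegrand hψ hψs w).integrableOn]
  refine setIntegral_congr_fun measurableSet_Ioi fun u _ ↦ ?_
  push_cast
  ring

/-! ## The two substitution identities -/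

/-- **Reflected translate.** For a profile `f` vanishing on `(-∞, 0]`, the Weil transform of
`t ↦ f(a - t)` is `e^{(s-1/2)a} ∫₀^∞ f(u) e^{-(s-1/2)u} du` (substitute `t = a - u`). [folklore] -/
theorem loc_weilMellin_reflect (f : ℝ → ℝ) (hf0 : ∀ u ≤ 0, f u = 0) (a : ℝ) (s : ℂ) :
    weilMellin (fun t ↦ ((f (a - t) : ℝ) : ℂ)) s =
      Complex.exp ((s - 1 / 2) * (a : ℂ)) *
        ∫ u in Ioi (0 : ℝ), (f u : ℂ) * Complex.exp (-((s - 1 / 2) * (u : ℂ))) := by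
  unfold weilMellin
  have h1 : (fun t : ℝ ↦ ((f (a - t) : ℝ) : ℂ) * Complex.exp ((s - 1 / 2) * (t : ℂ))) =
      fun t : ℝ ↦ (fun u : ℝ ↦ ((f u : ℝ) : ℂ) *
        Complex.exp ((s - 1 / 2) * ((a - u : ℝ) : ℂ))) (a - t) := by
    funext t
    simp only [sub_sub_cancel]
  have h2 : ∫ u in Ioi (0 : ℝ), ((f u : ℝ) : ℂ) * Complex.exp ((s - 1 / 2) * ((a - u : ℝ) : ℂ)) =
      ∫ u, ((f u : ℝ) : ℂ) * Complex.exp ((s - 1 / 2) * ((a - u : ℝ) : ℂ)) :=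
    setIntegral_eq_integral_of_forall_compl_eq_zero fun u hu ↦ by
      rw [hf0 u (not_lt.1 hu), Complex.ofReal_zero, zero_mul]
  rw [h1, integral_sub_left_eq_self (fun u : ℝ ↦ ((f u : ℝ) : ℂ) *
    Complex.exp ((s - 1 / 2) * ((a - u : ℝ) : ℂ))) volume a, ← h2, ← integral_const_mul]
  refine setIntegral_congr_fun measurableSet_Ioi fun u _ ↦ ?_
  rw [mul_left_comm, ← Complex.exp_add]
  congr 2
  push_cast
  ring

/-- **Translate.** For a profile `f` vanishing on `(-∞, 0]`, the Weil transform of `t ↦ f(a + t)`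
is `e^{-(s-1/2)a} ∫₀^∞ f(u) e^{(s-1/2)u} du` (substitute `t = u - a`). [folklore] -/
theorem loc_weilMellin_translate (f : ℝ → ℝ) (hf0 : ∀ u ≤ 0, f u = 0) (a : ℝ) (s : ℂ) :
    weilMellin (fun t ↦ ((f (a + t) : ℝ) : ℂ)) s =
      Complex.exp (-((s - 1 / 2) * (a : ℂ))) *
        ∫ u in Ioi (0 : ℝ), (f u : ℂ) * Complex.exp ((s - 1 / 2) * (u : ℂ)) := by
  unfold weilMellin
  have h1 : (fun t : ℝ ↦ ((f (a + t) : ℝ) : ℂ) * Complex.exp ((s - 1 / 2) * (t : ℂ))) =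
      fun t : ℝ ↦ (fun u : ℝ ↦ ((f u : ℝ) : ℂ) *
        Complex.exp ((s - 1 / 2) * ((u - a : ℝ) : ℂ))) (a + t) := by
    funext t
    simp only [add_sub_cancel_left]
  have h2 : ∫ u in Ioi (0 : ℝ), ((f u : ℝ) : ℂ) * Complex.exp ((s - 1 / 2) * ((u - a : ℝ) : ℂ)) =
      ∫ u, ((f u : ℝ) : ℂ) * Complex.exp ((s - 1 / 2) * ((u - a : ℝ) : ℂ)) :=
    setIntegral_eq_integral_of_forall_compl_eq_zero fun u hu ↦ by
      rw [hf0 u (not_lt.1 hu), Complex.ofReal_zero, zero_mul]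
  rw [h1, integral_add_left_eq_self (μ := volume) (fun u : ℝ ↦ ((f u : ℝ) : ℂ) *
    Complex.exp ((s - 1 / 2) * ((u - a : ℝ) : ℂ))) a, ← h2, ← integral_const_mul]
  refine setIntegral_congr_fun measurableSet_Ioi fun u _ ↦ ?_
  rw [mul_left_comm, ← Complex.exp_add]
  congr 2
  push_cast
  ring

/-! ## The weighted bound -/

/-- **Weighted bound for the Laplace integral.**  For `Re w > 0` and a continuous compactly
supported real profile `φ` vanishing on `(-∞, b]` with `b ≥ 0`:
`‖∫₀^∞ φ(u) e^{-wu} du‖ ≤ e^{-(Re w) b} (∫₀^∞ φ² + 1/Re w) / 2`.  Indeed the norm is at most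
`∫_{u > b} |φ| e^{-ηu}` (`η = Re w`), and pointwise on `u > b`,
`2|φ| e^{-ηu} ≤ (φ² + 1) e^{-ηu} ≤ φ² e^{-ηb} + e^{-ηu}`, with `∫_{u>b} e^{-ηu} = e^{-ηb}/η`
(registered sub-goal of the item, stated in closed form). [folklore] -/
theorem loc_norm_lap_le :
    ∀ (φ : ℝ → ℝ), Continuous φ → HasCompactSupport φ → ∀ (b : ℝ), 0 ≤ b →
      (∀ u ≤ b, φ u = 0) → ∀ (w : ℂ), 0 < w.re →
      ‖∫ u in Set.Ioi (0 : ℝ), (φ u : ℂ) * Complex.exp (-(w * (u : ℂ)))‖ ≤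
        Real.exp (-(w.re * b)) * ((∫ u in Set.Ioi (0 : ℝ), φ u ^ 2) + 1 / w.re) / 2 := by
  intro φ hφ hφs b hb hφ0 w hw
  set η : ℝ := w.re with hη
  -- the norm goes inside
  have h1 : ‖∫ u in Ioi (0 : ℝ), (φ u : ℂ) * Complex.exp (-(w * (u : ℂ)))‖ ≤
      ∫ u in Ioi (0 : ℝ), ‖φ u‖ * Real.exp (-(η * u)) := by
    refine (norm_integral_le_integral_norm _).trans_eq
      (setIntegral_congr_fun measurableSet_Ioi fun u _ ↦ ?_)
    rw [norm_mul, Complex.norm_real, loc_norm_cexp_neg_mul]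
  -- only `u > b` matters
  have h2 : ∫ u in Ioi (0 : ℝ), ‖φ u‖ * Real.exp (-(η * u)) =
      ∫ u in Ioi b, ‖φ u‖ * Real.exp (-(η * u)) :=
    setIntegral_eq_of_subset_of_forall_sdiff_eq_zero measurableSet_Ioi (Ioi_subset_Ioi hb)
      fun u hu ↦ by rw [hφ0 u (not_lt.1 hu.2), norm_zero, zero_mul]
  -- integrability
  have hil' : Integrable (fun u ↦ ‖φ u‖ * Real.exp (-(η * u))) :=
    (hφ.norm.mul (by fun_prop)).integrable_of_hasCompactSupport hφs.norm.mul_right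
  have hil : IntegrableOn (fun u ↦ ‖φ u‖ * Real.exp (-(η * u))) (Ioi b) := hil'.integrableOn
  have hc2 : HasCompactSupport (fun u ↦ φ u ^ 2) :=
    hφs.comp_left (g := fun x : ℝ ↦ x ^ 2) (zero_pow two_ne_zero)
  have hsq : Integrable fun u ↦ φ u ^ 2 := (hφ.pow 2).integrable_of_hasCompactSupport hc2
  have hexp : IntegrableOn (fun u ↦ Real.exp (-(η * u))) (Ioi b) := by
    simpa only [neg_mul] using exp_neg_integrableOn_Ioi b hw
  have hir' : IntegrableOn (fun u ↦ Real.exp (-(η * b)) * φ u ^ 2 + Real.exp (-(η * u)))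
      (Ioi b) :=
    (hsq.integrableOn.const_mul (Real.exp (-(η * b)))).add hexp
  have hir : IntegrableOn (fun u ↦ (Real.exp (-(η * b)) * φ u ^ 2 + Real.exp (-(η * u))) / 2)
      (Ioi b) :=
    hir'.div_const 2
  -- the pointwise bound on `u > b`
  have h3 : ∫ u in Ioi b, ‖φ u‖ * Real.exp (-(η * u)) ≤
      ∫ u in Ioi b, (Real.exp (-(η * b)) * φ u ^ 2 + Real.exp (-(η * u))) / 2 := by
    refine setIntegral_mono_on hil hir measurableSet_Ioi fun u hu ↦ ?_
    have hE : 0 < Real.exp (-(η * u)) := Real.exp_pos _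
    have hEle : Real.exp (-(η * u)) ≤ Real.exp (-(η * b)) :=
      Real.exp_le_exp.2 (neg_le_neg (mul_le_mul_of_nonneg_left (le_of_lt hu) hw.le))
    have hx : ‖φ u‖ ^ 2 = φ u ^ 2 := by rw [Real.norm_eq_abs, sq_abs]
    nlinarith [mul_nonneg (sq_nonneg (‖φ u‖ - 1)) hE.le,
      mul_nonneg (sq_nonneg (φ u)) (sub_nonneg.2 hEle), norm_nonneg (φ u)]
  -- evaluate the right-hand side
  have h4 : ∫ u in Ioi b, (Real.exp (-(η * b)) * φ u ^ 2 + Real.exp (-(η * u))) / 2 =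
      (Real.exp (-(η * b)) * (∫ u in Ioi b, φ u ^ 2) + Real.exp (-(η * b)) / η) / 2 := by
    rw [integral_div, integral_add (hsq.integrableOn.const_mul _) hexp, integral_const_mul]
    congr 2
    have h := integral_exp_mul_Ioi (neg_lt_zero.2 hw) b
    simp only [neg_mul] at h
    rw [h]
    field_simp
  have h5 : ∫ u in Ioi b, φ u ^ 2 ≤ ∫ u in Ioi (0 : ℝ), φ u ^ 2 :=
    setIntegral_mono_set hsq.integrableOn (Eventually.of_forall fun u ↦ sq_nonneg (φ u))
      (Ioi_subset_Ioi hb).eventuallyLE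
  have hEb : 0 < Real.exp (-(η * b)) := Real.exp_pos _
  calc ‖∫ u in Ioi (0 : ℝ), (φ u : ℂ) * Complex.exp (-(w * (u : ℂ)))‖
      ≤ ∫ u in Ioi b, ‖φ u‖ * Real.exp (-(η * u)) := h1.trans_eq h2
    _ ≤ (Real.exp (-(η * b)) * (∫ u in Ioi b, φ u ^ 2) + Real.exp (-(η * b)) / η) / 2 :=
        h3.trans_eq h4
    _ ≤ Real.exp (-(η * b)) * ((∫ u in Ioi (0 : ℝ), φ u ^ 2) + 1 / η) / 2 := by
        have := mul_le_mul_of_nonneg_left h5 hEb.le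
        have hη' : Real.exp (-(η * b)) / η = Real.exp (-(η * b)) * (1 / η) := by ring
        rw [hη']
        nlinarith

end Summit.RiemannHypothesis.RiemannHypothesis.Theorems.WeilParityOffLineParityDetection

end
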